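import Literature.AlgebraicGeometry.Resolution.PointBlowupMohStability
import Literature.AlgebraicGeometry.Resolution.PointBlowupShadeCentres
import HarnessLib

/-!
# Moh's bound and Moh's stability theorem at order `p` for permissible coordinate centres of
  any dimension, in every dimension — by transfer from the point case

Topic: `Literature/AlgebraicGeometry/Resolution`. Reproduction (cell `pub-hironaka`, unit
`b2b-hironaka-cp4`, DIM-4 CENSUS gen 12; sequel of `PointBlowupMohBound.lean` /
`PointBlowupMohStability.lean` (point blow-ups) on the coordinate-centre model `CentreBlowup` of
`PointBlowupShadeCentres.lean`) of the CENTRE half of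

* T. T. Moh, *On a stability theorem for local uniformization in characteristic `p`*,
  Publ. RIMS Kyoto Univ. **23** (1987) 965–973 [Moh1987]: Moh's blow-ups are "monoidal
  transformations" in PERMISSIBLE CENTRES `P` — "Definition. An ideal `P` is said to be a
  permissible center if there is a system of parameters `(y₁,…,y_n)` such that (1) all `x_i`'s
  with `m_i ≠ 0` are among them, (2) a part of them generate `P`, (3) `F ∈ P^d` where
  `d = ord F`" (p. 967; Moh's `F` is the residual factor, the exceptional monomial `∏ x_i^{m_i}`
  being kept apart, so `d` is the shade) — and his Stability Theorem (p. 966: "After a permissible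
  blowup … `ord F̄ ≤ d + p^{e−1}` and successive permissible blow-ups will not increase `ord F̄`
  beyond the bound `d + p^{e−1}` … until it drops to `d` or less") is about such centres of any
  dimension. The point-blow-up files prove it for `e = 1` and centres of dimension `0`; this file
  removes the restriction on the dimension of the (coordinate) centre;
* H. Hauser, S. Perlega, Publ. RIMS **55** (2019) [HauserPerlega2019PRIMS], §2: blow-ups in a
  regular centre `Z` having normal crossings with `D` and "contained in … the equimultiple loci of
  `J` and `I`", read in the `x₁`-chart by "`x_i ↦ x₁x_i` for `i ∈ S`" — the tree's
  `CentreBlowup.chartExponent/chartTransform/step` (`PointBlowupShadeCentres.lean`, no theorem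
  about them so far); §3 Theorem (9) (the bound `+ c!/p` for any such centre); and
  [HauserPerlega2019, §3]: "in the examples one could choose at various instances a larger
  center than a point and thus would end up with a different sequence of blowups" — at order
  `p³` the choice of larger centres matters; THIS FILE shows that at order `p` NO choice of
  Moh-permissible coordinate centres lets the residual order exceed its running minimum by more
  than one.

## What is proved (every field `K` of characteristic `p`, every finite index type `σ`, the
## `CState`/`step`/`shade` semantics of `PointBlowupShadeCentres.lean`)

A centre is a set `S` of variables (`C_S = {x = 0, y_i = 0 (i ∈ S)}`), blown up in the chart of
some `j ∈ S`, at a point `b` of the fibre over the origin (`b_j = 0`, and `b_i = 0` for `i ∉ S`,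
as in `CentreBlowup.IsKangarooPoint`). MOH-PERMISSIBILITY of `S` for the state `(F, r)` of order
`o` and shade `a = o − |r|`: every monomial `y^d` of `F` has `degIn S d ≥ p` (`C_S` lies in the
`p`-fold locus of `x^p + F`) and `degIn S d ≥ degIn S r + a` (`C_S` lies in the equimultiple
locus of the residual factor `g`, `F = y^r g`: Moh's (3)); then `ord_{C_S} F = degIn S r + a`
(`ordAlong_eq_of_perm`).

* **`lift_step_F` — THE TRANSFER IDENTITY**: with `φ : y_i ↦ y_j·y_i (i ∉ S), y_i ↦ y_i (i ∈ S)`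
  (the `K`-algebra map `aeval (fun i => if i ∈ S then X i else X j * X i)`, written out in every
  statement; no new definition), `φ((CentreBlowup.step p S j b s).F) = (PointBlowup.step p j b
  (F, r)).F`: the point chart is the `C_S`-chart followed by `φ` (`lift_chartExponent`,
  `lift_chartTransform`), `φ` commutes with the translation (`lift_translate`, `b` supported on
  `S ∖ {j}`) and with the cleaning (`lift_deletePthPowers`, since `ψ(e) = e + (Σ_{i∉S} e_i)·e_j`
  is a `p`-th power exponent iff `e` is, `isPthPowerExponent_lift_iff`). `φ` is injective on
  monomials (`lift_injective`, `coeff_lift`) and raises degrees by `Σ_{i∉S} e_i`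
  (`degree_lift`), hence orders by at least `Σ_{i∉S} r_i` (`le_ordZero_lift`), which is exactly
  `|r′_point| − |r′_centre|` (`degree_step_r_add`). Consequently
* **`shade_step_le_shade_pointStep`**: `shade(CentreBlowup.step p S j b s) ≤
  shade(PointBlowup.step p j b (F, r))` — the shade after a permissible `C_S`-blow-up is at most
  the shade after the point blow-up with the same chart and point; and everything transfers:
* **`mohBound_one`** (Moh's one-blow-up bound `+1` for permissible coordinate centres of any
  dimension, every dimension, [Moh87] p. 966 / [HP19b] (9) with `c = p`);
  **`shade_step_le_of_witness`** (Moh's witness — a non-exceptional variable with an initial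
  exponent prime to `p` — forbids an increase under EVERY permissible coordinate centre, every
  chart, every point of the fibre); **`exists_witness_of_shadeIncreases`** (an increase creates
  the witness); **`exists_witness_step_of_shade_eq`** (the witness survives stalls); and
* **`shade_le_shade_add_one_along` — MOH'S STABILITY THEOREM (`e = 1`) FOR ARBITRARY SEQUENCES
  OF MOH-PERMISSIBLE COORDINATE-CENTRE BLOW-UPS**: `shade(s_m) ≤ shade(s_n) + 1` for all
  `n ≤ m`, the centres `S_n`, charts `j_n ∈ S_n` and points `b_n` being arbitrary at every stage;
  `shade_eq_add_one_until_drop` (Moh's wording).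
* Consistency (`§5`): `ordAlong_univ`, `chartTransform_univ`, **`step_univ_toState`** — the blow-up
  of `C_univ` IS the point blow-up of `PointBlowupShade.lean`, so §4 contains the point theorems.
* Infrastructure: `degIn` arithmetic (`degIn_add_sum_compl`, `degIn_le_degree`, `degIn_add`,
  `degIn_lift`, …), `lift_monomial`, `lift_eq_sum`, `exists_of_mem_support_lift`, `lift_ne_zero`,
  `newMult_le_of_mem_support_step`, `step_F_ne_zero`, `deletePthPowers_step`, `step_r_eq`,
  `step_r_apply_of_ne`, `ordZero_pointStep_eq`, `degree_eq_of_lift_initial`.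

## What is NOT proved here (scope, honest)

* Only COORDINATE centres `C_S` through the origin in the given variables (Moh's centres are of
  this form in HIS adapted parameters `(y)`, p. 967 (1)–(2); a regular centre with normal
  crossings need not be a coordinate subspace of the coordinates in which `F` is currently
  written — no re-coordinatisation is modelled), only points of the fibre over the origin
  (`b_i = 0` off `S`: the atlas' convention "other points of `C_S` are separate states"), only
  `e = 1`, and the model's cleaning (perfect-field reading, see the reading notes of
  `PointBlowupMohBound.lean`). Moh's valuation plays no role: every chart and point is allowed.
* The atlas' admissibility `CentreBlowup.IsAdmissibleCentre` (general-point order convention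
  `genericOrder`) is a different predicate and is not related here to Moh-permissibility.
* Nothing here is a statement about resolution of singularities; census value only (row O5 of
  the dimension-4 census of `pub-hironaka`: at multiplicity `p` the classical residual datum is
  bounded by its running minimum `+ 1` along every sequence of permissible coordinate-centre
  blow-ups of any dimensions, in every dimension — so the "larger centre" escape that matters at
  order `p³` [HP19, §3] changes nothing at order `p`; what remains open there is the eventual
  DECREASE).
-/

noncomputable section

open MvPolynomial Finset

open scoped BigOperators

namespace Literature.AlgebraicGeometry.Resolution

open Literature.AlgebraicGeometry.Resolution.Hauser2010
open Literature.Barriers.ResolutionOfSingularities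

namespace CentreBlowup

/-! ## 1. The comparison of exponents: `ψ(e) = e + (Σ_{i ∉ S} e_i)·e_j` -/

section Exponents

variable {σ : Type*}

/-- `Σ_{i ∈ S} e_i + Σ_{i ∉ S} e_i = |e|`. [folklore] -/
theorem degIn_add_sum_compl [Fintype σ] [DecidableEq σ] (S : Finset σ) (e : σ →₀ ℕ) :
    degIn S e + ∑ i ∈ Sᶜ, e i = e.degree := by
  rw [degIn, Finsupp.degree_eq_sum, ← Finset.sum_add_sum_compl S]

/-- `Σ_{i ∈ S} e_i ≤ |e|`. [folklore] -/
theorem degIn_le_degree [Fintype σ] [DecidableEq σ] (S : Finset σ) (e : σ →₀ ℕ) :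
    degIn S e ≤ e.degree := by
  have := degIn_add_sum_compl S e
  omega

/-- `degIn` is additive. [folklore] -/
theorem degIn_add (S : Finset σ) (e e' : σ →₀ ℕ) : degIn S (e + e') = degIn S e + degIn S e' := by
  simp only [degIn, Finsupp.coe_add, Pi.add_apply, Finset.sum_add_distrib]

/-- `degIn` is monotone. [folklore] -/
theorem degIn_le_degIn_of_le (S : Finset σ) {e e' : σ →₀ ℕ} (h : e ≤ e') :
    degIn S e ≤ degIn S e' :=
  Finset.sum_le_sum fun i _ => Finsupp.le_def.mp h i

/-- A coordinate in `S` is bounded by `degIn S`. [folklore] -/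
theorem apply_le_degIn {S : Finset σ} {i : σ} (hi : i ∈ S) (e : σ →₀ ℕ) : e i ≤ degIn S e :=
  Finset.single_le_sum (fun k _ => Nat.zero_le (e k)) hi

/-- The comparison exponent `ψ(e) = e + (|e| − degIn S e)·e_j`, pointwise. [folklore] -/
theorem lift_apply [DecidableEq σ] (S : Finset σ) (j : σ) (e : σ →₀ ℕ) (i : σ) :
    (e + Finsupp.single j (e.degree - degIn S e)) i =
      if i = j then e j + (e.degree - degIn S e) else e i := by
  rw [Finsupp.add_apply, Finsupp.single_apply]
  by_cases h : i = j
  · subst h; rw [if_pos rfl, if_pos rfl]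
  · rw [if_neg (Ne.symm h), if_neg h, add_zero]

/-- Degree of the comparison exponent: `|ψ(e)| = |e| + (|e| − degIn S e)`. [folklore] -/
theorem degree_lift (S : Finset σ) (j : σ) (e : σ →₀ ℕ) :
    (e + Finsupp.single j (e.degree - degIn S e)).degree = e.degree + (e.degree - degIn S e) := by
  rw [map_add, Finsupp.degree_single]

/-- `degIn S` of the comparison exponent, for `j ∈ S`: `degIn S ψ(e) = |e|`. [folklore] -/
theorem degIn_lift [Fintype σ] [DecidableEq σ] {S : Finset σ} {j : σ} (hj : j ∈ S) (e : σ →₀ ℕ) :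
    degIn S (e + Finsupp.single j (e.degree - degIn S e)) = e.degree := by
  rw [degIn_add]
  have h1 : degIn S (Finsupp.single j (e.degree - degIn S e)) = e.degree - degIn S e := by
    rw [degIn, Finset.sum_eq_single j]
    · rw [Finsupp.single_eq_same]
    · intro i _ hij; rw [Finsupp.single_apply, if_neg (Ne.symm hij)]
    · intro h; exact (h hj).elim
  rw [h1]
  have := degIn_le_degree S e
  omega

/-- The comparison exponent map is injective (for `j ∈ S`). [folklore] -/
theorem lift_injective [Fintype σ] [DecidableEq σ] {S : Finset σ} {j : σ} (hj : j ∈ S)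
    {e e' : σ →₀ ℕ}
    (h : e + Finsupp.single j (e.degree - degIn S e) = e' + Finsupp.single j (e'.degree - degIn S e')) :
    e = e' := by
  have hdeg : e.degree = e'.degree := by
    have := congrArg (degIn S) h
    rwa [degIn_lift hj, degIn_lift hj] at this
  have hne : ∀ i, i ≠ j → e i = e' i := fun i hi => by
    have := DFunLike.congr_fun h i
    rwa [lift_apply, lift_apply, if_neg hi, if_neg hi] at this
  have hj' : e j = e' j := by
    have h1 := PointBlowup.degree_eq_add_sum_erase j e
    have h2 := PointBlowup.degree_eq_add_sum_erase j e'
    have h3 : ∑ i ∈ univ.erase j, e i = ∑ i ∈ univ.erase j, e' i :=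
      Finset.sum_congr rfl fun i hi => hne i (Finset.ne_of_mem_erase hi)
    omega
  ext i
  by_cases hi : i = j
  · subst hi; exact hj'
  · exact hne i hi

/-- **The centre chart exponent lifts to the point chart exponent**: for `j ∈ S` and
`q ≤ degIn S d`, `ψ(d^S) = d^` where `d^S = d.update j (degIn S d − q)` (blow-up of `C_S`) and
`d^ = d.update j (|d| − q)` (blow-up of the point): the substitution `y_i ↦ y_j y_i` (`i ∉ S`)
after the `C_S`-chart is the point chart. [folklore] -/
theorem lift_chartExponent [Fintype σ] [DecidableEq σ] {S : Finset σ} {j : σ} (hj : j ∈ S) {q : ℕ}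
    {d : σ →₀ ℕ} (hq : q ≤ degIn S d) :
    chartExponent q S j d + Finsupp.single j
        ((chartExponent q S j d).degree - degIn S (chartExponent q S j d)) =
      PointBlowup.chartExponent q j d := by
  have hcS : degIn S (chartExponent q S j d) + d j = degIn S d + (degIn S d - q) := by
    unfold chartExponent degIn
    rw [Finsupp.coe_update, Finset.sum_update_of_mem hj, ← Finset.add_sum_erase S (⇑d) hj,
      Finset.sdiff_singleton_eq_erase]
    ring
  have hcdeg : (chartExponent q S j d).degree + d j = d.degree + (degIn S d - q) := by
    unfold chartExponent
    exact PointBlowup.degree_update_add d j _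
  ext i
  rw [lift_apply, PointBlowup.chartExponent_apply]
  by_cases hi : i = j
  · subst hi
    rw [if_pos rfl, if_pos rfl]
    have hcj : chartExponent q S i d i = degIn S d - q := by
      unfold chartExponent; rw [Finsupp.update_apply, if_pos rfl]
    rw [hcj]
    have h1 := degIn_le_degree S d
    omega
  · rw [if_neg hi, if_neg hi]
    unfold chartExponent
    rw [Finsupp.update_apply, if_neg hi]

end Exponents


/-! ## 2. The comparison homomorphism `φ : y_i ↦ y_j·y_i (i ∉ S)`, `y_i ↦ y_i (i ∈ S)` -/

section Lift

variable {σ : Type*} {K : Type*} [Field K] [Fintype σ] [DecidableEq σ]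

/-- `ψ` is additive. [folklore] -/
theorem lift_add (S : Finset σ) (j : σ) (e e' : σ →₀ ℕ) :
    (e + e') + Finsupp.single j ((e + e').degree - degIn S (e + e')) =
      (e + Finsupp.single j (e.degree - degIn S e)) +
        (e' + Finsupp.single j (e'.degree - degIn S e')) := by
  have h1 := degIn_le_degree S e
  have h2 := degIn_le_degree S e'
  have h3 : (e + e').degree - degIn S (e + e') =
      (e.degree - degIn S e) + (e'.degree - degIn S e') := by
    rw [map_add, degIn_add]; omega
  rw [h3, Finsupp.single_add]
  abel

/-- **`φ` on monomials**: `φ(c·y^e) = c·y^{ψ(e)}` with `ψ(e) = e + (Σ_{i∉S} e_i)·e_j`. [folklore] -/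
theorem lift_monomial (S : Finset σ) (j : σ) (e : σ →₀ ℕ) (c : K) :
    aeval (fun i => if i ∈ S then (X i : MvPolynomial σ K) else X j * X i) (monomial e c) =
      monomial (e + Finsupp.single j (e.degree - degIn S e)) c := by
  induction e using Finsupp.induction with
  | zero =>
    simp only [map_zero, degIn, Finsupp.coe_zero, Pi.zero_apply, Finset.sum_const_zero,
      Nat.sub_self, Finsupp.single_zero, add_zero]
    rw [← C_apply, algHom_C, algebraMap_eq, C_apply]
  | single_add a n f _ _ ih =>
    have hsplit : monomial (Finsupp.single a n + f) c =
        (X a : MvPolynomial σ K) ^ n * monomial f c := by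
      rw [X_pow_eq_monomial, monomial_mul, one_mul]
    rw [hsplit, map_mul, map_pow, aeval_X, ih, lift_add]
    have hsa : Finsupp.single a n + Finsupp.single j ((Finsupp.single a n).degree
        - degIn S (Finsupp.single a n)) = if a ∈ S then Finsupp.single a n
          else Finsupp.single a n + Finsupp.single j n := by
      rw [Finsupp.degree_single]
      have : degIn S (Finsupp.single a n) = if a ∈ S then n else 0 := by
        rw [degIn]
        split_ifs with ha
        · rw [Finset.sum_eq_single a]
          · rw [Finsupp.single_eq_same]
          · intro i _ hia; rw [Finsupp.single_apply, if_neg (Ne.symm hia)]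
          · intro h; exact (h ha).elim
        · exact Finset.sum_eq_zero fun i hi => by
            rw [Finsupp.single_apply, if_neg]
            rintro rfl; exact ha hi
      rw [this]
      split_ifs with ha
      · rw [Nat.sub_self, Finsupp.single_zero, add_zero]
      · rw [Nat.sub_zero]
    rw [hsa]
    split_ifs with ha
    · rw [X_pow_eq_monomial, monomial_mul, one_mul]
    · rw [mul_pow, X_pow_eq_monomial, X_pow_eq_monomial, monomial_mul, monomial_mul, one_mul, one_mul,
        add_comm (Finsupp.single j n) (Finsupp.single a n)]

/-- `φ` termwise on the monomial expansion. [folklore] -/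
theorem lift_eq_sum (S : Finset σ) (j : σ) (P : MvPolynomial σ K) :
    aeval (fun i => if i ∈ S then (X i : MvPolynomial σ K) else X j * X i) P =
      ∑ e ∈ P.support, monomial (e + Finsupp.single j (e.degree - degIn S e)) (coeff e P) := by
  conv_lhs => rw [P.as_sum]
  rw [map_sum]
  exact Finset.sum_congr rfl fun e _ => lift_monomial S j e _

/-- The coefficients of `φ P`: at `ψ(e)` it is `coeff_e P` (`j ∈ S`). [folklore] -/
theorem coeff_lift {S : Finset σ} {j : σ} (hj : j ∈ S) (P : MvPolynomial σ K) (e : σ →₀ ℕ) :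
    coeff (e + Finsupp.single j (e.degree - degIn S e))
      (aeval (fun i => if i ∈ S then (X i : MvPolynomial σ K) else X j * X i) P) = coeff e P := by
  rw [lift_eq_sum]
  by_cases he : e ∈ P.support
  · rw [PointBlowup.coeff_sum_monomial_of_injOn P.support
      (fun e => e + Finsupp.single j (e.degree - degIn S e)) (fun e => coeff e P) he]
    intro e' _ _ h
    exact lift_injective hj h
  · rw [MvPolynomial.notMem_support_iff.mp he, coeff_sum]
    refine Finset.sum_eq_zero fun e' he' => ?_
    rw [coeff_monomial, if_neg]
    intro h
    exact he ((lift_injective hj h) ▸ he')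

/-- The support of `φ P` is the image of the support of `P` under `ψ`. [folklore] -/
theorem exists_of_mem_support_lift (S : Finset σ) (j : σ) (P : MvPolynomial σ K) {E : σ →₀ ℕ}
    (hE : E ∈ (aeval (fun i => if i ∈ S then (X i : MvPolynomial σ K) else X j * X i) P).support) :
    ∃ e ∈ P.support, e + Finsupp.single j (e.degree - degIn S e) = E := by
  rw [lift_eq_sum] at hE
  obtain ⟨e, he, -, h⟩ := PointBlowup.exists_of_mem_support_sum_monomial _ _ _ hE
  exact ⟨e, he, h⟩

/-- `φ` preserves non-vanishing (`j ∈ S`). [folklore] -/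
theorem lift_ne_zero {S : Finset σ} {j : σ} (hj : j ∈ S) {P : MvPolynomial σ K} (hP : P ≠ 0) :
    aeval (fun i => if i ∈ S then (X i : MvPolynomial σ K) else X j * X i) P ≠ 0 := by
  obtain ⟨e, he⟩ := MvPolynomial.support_nonempty.mpr hP
  intro h
  have := coeff_lift hj P e
  rw [h, coeff_zero] at this
  exact (MvPolynomial.mem_support_iff.mp he) this.symm

/-- **`φ` of the `C_S`-chart transform is the point chart transform** (for `j ∈ S`, on polynomials
all of whose monomials have `degIn S ≥ q`). [folklore] -/
theorem lift_chartTransform {S : Finset σ} {j : σ} (hj : j ∈ S) (q : ℕ) (F : MvPolynomial σ K)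
    (hq : ∀ d ∈ F.support, q ≤ degIn S d) :
    aeval (fun i => if i ∈ S then (X i : MvPolynomial σ K) else X j * X i) (chartTransform q S j F) =
      PointBlowup.chartTransform q j F := by
  unfold chartTransform PointBlowup.chartTransform
  rw [map_sum]
  refine Finset.sum_congr rfl fun d hd => ?_
  rw [lift_monomial, lift_chartExponent hj (hq d hd)]

omit [Fintype σ] in
/-- **`φ` commutes with translations** supported on `S ∖ {j}` (`b_j = 0`, `b_i = 0` off `S`):
both are `K`-algebra maps and they agree on the variables. [folklore] -/
theorem lift_translate (S : Finset σ) {j : σ} (b : σ → K) (hbj : b j = 0)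
    (hbN : ∀ i, i ∉ S → b i = 0) (P : MvPolynomial σ K) :
    aeval (fun i => if i ∈ S then (X i : MvPolynomial σ K) else X j * X i) (PointBlowup.translate b P) =
      PointBlowup.translate b
        (aeval (fun i => if i ∈ S then (X i : MvPolynomial σ K) else X j * X i) P) := by
  unfold PointBlowup.translate
  have hcomp : (aeval (fun i => if i ∈ S then (X i : MvPolynomial σ K) else X j * X i)).comp
      (aeval fun i => (X i + C (b i) : MvPolynomial σ K)) =
      (aeval fun i => (X i + C (b i) : MvPolynomial σ K)).comp
        (aeval (fun i => if i ∈ S then (X i : MvPolynomial σ K) else X j * X i)) := by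
    refine MvPolynomial.algHom_ext fun i => ?_
    by_cases hi : i ∈ S
    · simp only [AlgHom.comp_apply, aeval_X, map_add, algHom_C, algebraMap_eq, if_pos hi]
    · simp only [AlgHom.comp_apply, aeval_X, map_mul, if_neg hi, hbj, hbN i hi, C_0, add_zero]
  have := congrArg (fun ψ : MvPolynomial σ K →ₐ[K] MvPolynomial σ K => ψ P) hcomp
  simpa only [AlgHom.comp_apply] using this

/-- `ψ(e)` is a `p`-th power exponent iff `e` is (`j ∈ S`). [folklore] -/
theorem isPthPowerExponent_lift_iff {S : Finset σ} {j : σ} (hj : j ∈ S) (p : ℕ)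
    (e : σ →₀ ℕ) :
    IsPthPowerExponent p (e + Finsupp.single j (e.degree - degIn S e)) ↔ IsPthPowerExponent p e := by
  rw [isPthPowerExponent_iff, isPthPowerExponent_iff]
  have hcompl : e.degree - degIn S e = ∑ i ∈ Sᶜ, e i := by
    have := degIn_add_sum_compl S e; omega
  constructor
  · intro h i
    by_cases hi : i = j
    · subst hi
      have hothers : ∀ k, k ≠ i → p ∣ e k := fun k hk => by
        have := h k; rwa [lift_apply, if_neg hk] at this
      have hsum : p ∣ ∑ k ∈ Sᶜ, e k := Finset.dvd_sum fun k hk => hothers k (by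
        rintro rfl; exact (Finset.mem_compl.mp hk) hj)
      have := h i
      rw [lift_apply, if_pos rfl, hcompl] at this
      exact (Nat.dvd_add_left hsum).mp this
    · have := h i; rwa [lift_apply, if_neg hi] at this
  · intro h i
    rw [lift_apply]
    split_ifs with hi
    · rw [hcompl]; exact dvd_add (h j) (Finset.dvd_sum fun k _ => h k)
    · exact h i

omit [Fintype σ] in
/-- Cleaning a finite sum termwise. [folklore] -/
theorem deletePthPowers_finset_sum {ι : Type*} (q : ℕ) (t : Finset ι) (P : ι → MvPolynomial σ K) :
    deletePthPowers q (∑ x ∈ t, P x) = ∑ x ∈ t, deletePthPowers q (P x) := by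
  induction t using Finset.cons_induction with
  | empty => rw [Finset.sum_empty, Finset.sum_empty, deletePthPowers_zero]
  | cons a s ha ih => rw [Finset.sum_cons, Finset.sum_cons, deletePthPowers_add, ih]

/-- **`φ` commutes with the cleaning** (`j ∈ S`). [folklore] -/
theorem lift_deletePthPowers {S : Finset σ} {j : σ} (hj : j ∈ S) (p : ℕ) (P : MvPolynomial σ K) :
    aeval (fun i => if i ∈ S then (X i : MvPolynomial σ K) else X j * X i) (deletePthPowers p P) =
      deletePthPowers p
        (aeval (fun i => if i ∈ S then (X i : MvPolynomial σ K) else X j * X i) P) := by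
  rw [lift_eq_sum S j P, deletePthPowers_finset_sum, lift_eq_sum]
  have hsupp : (deletePthPowers p P).support = P.support.filter fun e => ¬ IsPthPowerExponent p e := by
    ext e
    rw [MvPolynomial.mem_support_iff, coeff_deletePthPowers, Finset.mem_filter,
      MvPolynomial.mem_support_iff]
    constructor
    · intro h
      by_cases hP : IsPthPowerExponent p e
      · rw [if_pos hP] at h; exact (h rfl).elim
      · rw [if_neg hP] at h; exact ⟨h, hP⟩
    · rintro ⟨h, hP⟩; rwa [if_neg hP]
  rw [hsupp, Finset.sum_filter]
  refine Finset.sum_congr rfl fun e _ => ?_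
  rw [deletePthPowers_monomial]
  by_cases hP : IsPthPowerExponent p e
  · rw [if_neg (not_not_intro hP), if_pos ((isPthPowerExponent_lift_iff hj p e).mpr hP)]
  · rw [if_pos hP, if_neg (mt (isPthPowerExponent_lift_iff hj p e).mp hP), coeff_deletePthPowers,
      if_neg hP]

end Lift


/-! ## 3. Transfer: one `C_S`-step lifts to one point-step -/

section Transfer

variable {σ : Type*} {K : Type*} [Field K] [Fintype σ] [DecidableEq σ] [DecidableEq K]
variable (p : ℕ) [hp : Fact p.Prime] [CharP K p]

omit hp [CharP K p] in
/-- **`φ` of the residual polynomial after a `C_S`-step is the residual polynomial after the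
point-step** (same chart `j ∈ S`, same point `b` of the fibre over the origin: `b_j = 0`, `b_i = 0`
for `i ∉ S`), provided every monomial of `F` has `degIn S ≥ q` (the centre lies in the `q`-fold
locus of `x^q + F`). [folklore] -/
theorem lift_step_F (q : ℕ) {S : Finset σ} {j : σ} (hj : j ∈ S) (b : σ → K) (hbj : b j = 0)
    (hbN : ∀ i, i ∉ S → b i = 0) (s : CState σ K) (hq : ∀ d ∈ s.F.support, q ≤ degIn S d) :
    aeval (fun i => if i ∈ S then (X i : MvPolynomial σ K) else X j * X i) (step q S j b s).F =
      (PointBlowup.step q j b s.toState).F := by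
  show aeval _ (deletePthPowers q (PointBlowup.translate b (chartTransform q S j s.F))) =
    deletePthPowers q (PointBlowup.translate b (PointBlowup.chartTransform q j s.F))
  rw [lift_deletePthPowers hj, lift_translate S b hbj hbN, lift_chartTransform hj q s.F hq]

omit [Fintype σ] [DecidableEq σ] [DecidableEq K] hp [CharP K p] in
/-- The shade of a `CState` with non-zero residual polynomial of order `o`. [folklore] -/
theorem CState.shade_eq_of_ordZero_eq (s : CState σ K) {o : ℕ} (ho : ordZero s.F = o) :
    s.shade = ((o - s.r.degree : ℕ) : ℕ∞) := by
  unfold CState.shade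
  rw [ho]
  exact (ENat.coe_sub _ _).symm

omit [DecidableEq σ] [DecidableEq K] hp [CharP K p] in
/-- **The order along a Moh-permissible centre.** If every monomial `y^d` of `F = y^r·g` has
`degIn S d ≥ degIn S r + shade` (Moh's condition (3) "`F ∈ P^d` where `d = ord F`" for the
residual factor `g`, [Moh87] p. 967), then `ord_{C_S} F = degIn S r + shade`, attained at any
initial monomial. [cite: Moh1987, §1 (Definition of a permissible center)] -/
theorem ordAlong_eq_of_perm (S : Finset σ) (s : CState σ K) {o : ℕ} (ho : ordZero s.F = o)
    (hr : ∀ d ∈ s.F.support, s.r ≤ d)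
    (hperm : ∀ d ∈ s.F.support, degIn S s.r + (o - s.r.degree) ≤ degIn S d) :
    ordAlong S s.F = ((degIn S s.r + (o - s.r.degree) : ℕ) : ℕ∞) ∧
      ∀ d ∈ s.F.support, d.degree = o → degIn S d = degIn S s.r + (o - s.r.degree) := by
  classical
  obtain ⟨⟨d₀, hd₀, hd₀deg⟩, -⟩ := (ordZero_eq_nat_iff _ _).mp ho
  have hd₀s : d₀ ∈ s.F.support := MvPolynomial.mem_support_iff.mpr hd₀
  have hinit : ∀ d ∈ s.F.support, d.degree = o → degIn S d = degIn S s.r + (o - s.r.degree) := by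
    intro d hd hdo
    refine le_antisymm ?_ (hperm d hd)
    have h1 := degIn_add_sum_compl S d
    have h2 := degIn_add_sum_compl S s.r
    have h3 : ∑ i ∈ Sᶜ, s.r i ≤ ∑ i ∈ Sᶜ, d i :=
      Finset.sum_le_sum fun i _ => Finsupp.le_def.mp (hr d hd) i
    have h4 : s.r.degree ≤ d.degree := PointBlowup.degree_le_degree_of_le (hr d hd)
    omega
  refine ⟨le_antisymm ?_ ?_, hinit⟩
  · unfold ordAlong
    have := Finset.inf_le (f := fun d => (degIn S d : ℕ∞)) hd₀s
    refine le_trans this ?_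
    exact_mod_cast (hinit d₀ hd₀s hd₀deg).le
  · unfold ordAlong
    exact Finset.le_inf fun d hd => by exact_mod_cast hperm d hd

omit [Fintype σ] hp [CharP K p] in
/-- The new multiplicities after a `C_S`-step and after the point-step with the same chart and
point agree off `j`; at `j` they are `ord_{C_S} F − q` and `ord₀ F − q`. [folklore] -/
theorem step_r_apply_of_ne (q : ℕ) (S : Finset σ) {j i : σ} (hij : i ≠ j) (b : σ → K)
    (s : CState σ K) : (step q S j b s).r i = (PointBlowup.step q j b s.toState).r i := by
  show newMult q S j b s i = PointBlowup.newMult q j b s.toState i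
  unfold newMult PointBlowup.newMult
  rw [Finsupp.update_apply, Finsupp.update_apply, if_neg hij, if_neg hij]
  rfl

omit hp [CharP K p] in
/-- The new multiplicity of `{y_j = 0}` after a Moh-permissible `C_S`-step. [folklore] -/
theorem step_r_eq (q : ℕ) (S : Finset σ) (j : σ) (b : σ → K) (hbj : b j = 0) (s : CState σ K)
    {o : ℕ} (ho : ordZero s.F = o) (hr : ∀ d ∈ s.F.support, s.r ≤ d)
    (hperm : ∀ d ∈ s.F.support, degIn S s.r + (o - s.r.degree) ≤ degIn S d) :
    (step q S j b s).r =
      (s.r.update j (degIn S s.r + (o - s.r.degree) - q)).filter (fun i => b i = 0) := by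
  show newMult q S j b s = _
  unfold newMult
  rw [(ordAlong_eq_of_perm S s ho hr hperm).1, ENat.toNat_coe,
    PointBlowup.filter_update_of_pos s.r (Z := fun i => b i = 0) hbj]

omit hp [CharP K p] in
/-- **Degrees of the two new multiplicity vectors**: `|r′_point| = |r′_centre| + Σ_{i ∉ S} r_i`
under Moh-permissibility (then `ord₀ F − ord_{C_S} F = Σ_{i∉S} r_i`) and `q ≤ ord_{C_S} F`. [folklore] -/
theorem degree_step_r_add (q : ℕ) {S : Finset σ} {j : σ} (hj : j ∈ S) (b : σ → K) (hbj : b j = 0)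
    (hbN : ∀ i, i ∉ S → b i = 0) (s : CState σ K) {o : ℕ} (ho : ordZero s.F = o)
    (hr : ∀ d ∈ s.F.support, s.r ≤ d)
    (hperm : ∀ d ∈ s.F.support, degIn S s.r + (o - s.r.degree) ≤ degIn S d)
    (hq : q ≤ degIn S s.r + (o - s.r.degree)) :
    (PointBlowup.step q j b s.toState).r.degree =
      (step q S j b s).r.degree + (s.r.degree - degIn S s.r) ∧
    ∀ i, i ∉ S → (step q S j b s).r i = s.r i := by
  have hro : s.r.degree ≤ o := by
    obtain ⟨⟨d₀, hd₀, hd₀deg⟩, -⟩ := (ordZero_eq_nat_iff _ _).mp ho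
    exact hd₀deg ▸ PointBlowup.degree_le_degree_of_le (hr d₀ (MvPolynomial.mem_support_iff.mpr hd₀))
  have hcen := step_r_eq q S j b hbj s ho hr hperm
  have hpt : (PointBlowup.step q j b s.toState).r = (s.r.update j (o - q)).filter (fun i => b i = 0) :=
    PointBlowup.newMult_eq q j b hbj s.toState ho
  -- degrees of filtered updates: compare through the unfiltered updates
  have key : ∀ v : ℕ, ((s.r.update j v).filter (fun i => b i = 0)).degree + s.r j
      = (s.r.filter (fun i => b i = 0)).degree + v := by
    intro v
    have h := PointBlowup.degree_update_add (s.r.filter (fun i => b i = 0)) j v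
    rw [← PointBlowup.filter_update_of_pos s.r (Z := fun i => b i = 0) hbj v, Finsupp.filter_apply,
      if_pos hbj] at h
    exact h
  have k1 := key (o - q)
  have k2 := key (degIn S s.r + (o - s.r.degree) - q)
  have hSle := degIn_le_degree S s.r
  refine ⟨?_, ?_⟩
  · rw [hpt, hcen]; omega
  · intro i hi
    have hij : i ≠ j := by rintro rfl; exact hi hj
    rw [hcen, Finsupp.filter_apply, if_pos (hbN i hi), Finsupp.update_apply, if_neg hij]

omit [Fintype σ] [DecidableEq K] hp [CharP K p] in
/-- The point transform of a `CState`, termwise. [folklore] -/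
theorem pointTransform_eq_sum (q : ℕ) (S : Finset σ) (j : σ) (b : σ → K) (s : CState σ K) :
    pointTransform q S j b s =
      ∑ d ∈ s.F.support, PointBlowup.translate b (monomial (chartExponent q S j d) (coeff d s.F)) := by
  unfold pointTransform chartTransform PointBlowup.translate
  rw [map_sum]

omit hp [CharP K p] in
/-- **The new exceptional monomial divides the new residual polynomial** (`C_S`-step, `j ∈ S`,
point of the fibre over the origin). [folklore] -/
theorem newMult_le_of_mem_support_step (q : ℕ) (S : Finset σ) (j : σ) (b : σ → K)
    (hbj : b j = 0) (s : CState σ K) {o : ℕ} (ho : ordZero s.F = o)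
    (hr : ∀ d ∈ s.F.support, s.r ≤ d)
    (hperm : ∀ d ∈ s.F.support, degIn S s.r + (o - s.r.degree) ≤ degIn S d) :
    ∀ E ∈ (step q S j b s).F.support, (step q S j b s).r ≤ E := by
  intro E hE
  have hE' : coeff E (pointTransform q S j b s) ≠ 0 := by
    have h := MvPolynomial.mem_support_iff.mp hE
    change coeff E (deletePthPowers q (pointTransform q S j b s)) ≠ 0 at h
    rw [coeff_deletePthPowers] at h
    split_ifs at h with hP
    · exact (h rfl).elim
    · exact h
  rw [pointTransform_eq_sum, coeff_sum] at hE'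
  obtain ⟨d, hd, hne⟩ := Finset.exists_ne_zero_of_sum_ne_zero hE'
  have hle : E ≤ chartExponent q S j d := PointBlowup.le_of_coeff_translate_monomial_ne_zero b hne
  rw [step_r_eq q S j b hbj s ho hr hperm, Finsupp.le_def]
  intro i
  rw [Finsupp.filter_apply, Finsupp.update_apply]
  by_cases hbi : b i = 0
  · rw [if_pos hbi]
    have heq : E i = chartExponent q S j d i :=
      PointBlowup.apply_eq_of_coeff_translate_monomial_ne_zero b hbi hne
    rw [heq]
    unfold chartExponent
    rw [Finsupp.update_apply]
    by_cases hij : i = j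
    · rw [if_pos hij, if_pos hij]
      have := hperm d hd
      omega
    · rw [if_neg hij, if_neg hij]
      exact Finsupp.le_def.mp (hr d hd) i
  · rw [if_neg hbi]
    exact Nat.zero_le _

omit [Fintype σ] hp [CharP K p] in
/-- Cleaning is idempotent: the residual polynomial after a `C_S`-step is clean. [folklore] -/
theorem deletePthPowers_step (q : ℕ) (S : Finset σ) (j : σ) (b : σ → K) (s : CState σ K) :
    deletePthPowers q (step q S j b s).F = (step q S j b s).F :=
  PointBlowup.deletePthPowers_deletePthPowers q _

/-- A `C_S`-step of a cleaned Moh-permissible state is never the zero polynomial. [folklore] -/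
theorem step_F_ne_zero {S : Finset σ} {j : σ} (hj : j ∈ S) (b : σ → K) (hbj : b j = 0)
    (hbN : ∀ i, i ∉ S → b i = 0) (s : CState σ K) (hclean : deletePthPowers p s.F = s.F) {o : ℕ}
    (ho : ordZero s.F = o) (hr : ∀ d ∈ s.F.support, s.r ≤ d)
    (hq : ∀ d ∈ s.F.support, p ≤ degIn S d) : (step p S j b s).F ≠ 0 := by
  intro h0
  have hpo : p ≤ o := by
    obtain ⟨⟨d₀, hd₀, hd₀deg⟩, -⟩ := (ordZero_eq_nat_iff _ _).mp ho
    have := hq d₀ (MvPolynomial.mem_support_iff.mpr hd₀)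
    have h2 := degIn_le_degree S d₀
    omega
  have h := PointBlowup.step_F_ne_zero p j b hbj s.toState hclean ho hpo hr
  apply h
  rw [← lift_step_F p hj b hbj hbN s hq, h0, map_zero]

omit [DecidableEq K] hp [CharP K p] in
/-- **`φ` raises the order by at least the `S`-codegree bound**: if every monomial `y^e` of `P`
has `Σ_{i∉S} e_i ≥ m`, then `ord₀(φ P) ≥ ord₀ P + m`. [folklore] -/
theorem le_ordZero_lift (S : Finset σ) (j : σ) (P : MvPolynomial σ K) {oP m : ℕ}
    (hoP : ordZero P = oP) (hm : ∀ e ∈ P.support, m ≤ e.degree - degIn S e) :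
    ((oP + m : ℕ) : ℕ∞) ≤
      ordZero (aeval (fun i => if i ∈ S then (X i : MvPolynomial σ K) else X j * X i) P) := by
  refine le_ordZero_of_forall _ _ fun E hE => ?_
  obtain ⟨e, he, rfl⟩ := exists_of_mem_support_lift S j P (MvPolynomial.mem_support_iff.mpr hE)
  rw [degree_lift]
  have h1 : oP ≤ e.degree := by
    have := ordZero_le_of_coeff_ne_zero _ _ (MvPolynomial.mem_support_iff.mp he)
    rw [hoP] at this
    exact_mod_cast this
  have h2 := hm e he
  omega

omit [Fintype σ] [DecidableEq σ] [DecidableEq K] hp [CharP K p] in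
/-- **Pull-back of an initial monomial through `φ`** when the order of `φ P` is exactly
`ord₀ P + m`: its preimage is an initial monomial of `P` with `S`-codegree exactly `m`. [folklore] -/
theorem degree_eq_of_lift_initial (S : Finset σ) (j : σ) (P : MvPolynomial σ K) {oP m : ℕ}
    (hoP : ordZero P = oP) (hm : ∀ e ∈ P.support, m ≤ e.degree - degIn S e) {e : σ →₀ ℕ}
    (he : e ∈ P.support)
    (hdeg : (e + Finsupp.single j (e.degree - degIn S e)).degree = oP + m) :
    e.degree = oP ∧ e.degree - degIn S e = m := by
  rw [degree_lift] at hdeg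
  have h1 : oP ≤ e.degree := by
    have := ordZero_le_of_coeff_ne_zero _ _ (MvPolynomial.mem_support_iff.mp he)
    rw [hoP] at this
    exact_mod_cast this
  have h2 := hm e he
  omega

omit [DecidableEq σ] [DecidableEq K] hp [CharP K p] in
/-- From `p ≤ degIn S d` on the support: `p ≤ ord₀ F` and `p ≤ degIn S r + shade`. [folklore] -/
theorem le_of_forall_le_degIn (S : Finset σ) (s : CState σ K) {o q : ℕ} (ho : ordZero s.F = o)
    (hr : ∀ d ∈ s.F.support, s.r ≤ d)
    (hperm : ∀ d ∈ s.F.support, degIn S s.r + (o - s.r.degree) ≤ degIn S d)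
    (hq : ∀ d ∈ s.F.support, q ≤ degIn S d) :
    q ≤ o ∧ q ≤ degIn S s.r + (o - s.r.degree) ∧ s.r.degree ≤ o := by
  classical
  obtain ⟨⟨d₀, hd₀, hd₀deg⟩, -⟩ := (ordZero_eq_nat_iff _ _).mp ho
  have hd₀s : d₀ ∈ s.F.support := MvPolynomial.mem_support_iff.mpr hd₀
  have h1 := hq d₀ hd₀s
  have h2 := degIn_le_degree S d₀
  have h3 := (ordAlong_eq_of_perm S s ho hr hperm).2 d₀ hd₀s hd₀deg
  have h4 : s.r.degree ≤ d₀.degree := PointBlowup.degree_le_degree_of_le (hr d₀ hd₀s)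
  omega

omit hp [CharP K p] in
/-- **Comparison of shades.** After a Moh-permissible `C_S`-step (`j ∈ S`, point `b` of the
fibre over the origin) the shade is AT MOST the shade after the point-step with the same chart and
point: `φ` raises the order of the new residual polynomial by at least `Σ_{i∉S} r_i`
(`le_ordZero_lift`, the new exceptional monomial still having these exponents off `S`), which is
exactly the difference `|r′_point| − |r′_centre|` (`degree_step_r_add`). [folklore] -/
theorem shade_step_le_shade_pointStep {S : Finset σ} {j : σ} (hj : j ∈ S) (b : σ → K)
    (hbj : b j = 0) (hbN : ∀ i, i ∉ S → b i = 0) (s : CState σ K) {o : ℕ} (ho : ordZero s.F = o)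
    (hr : ∀ d ∈ s.F.support, s.r ≤ d) (hq : ∀ d ∈ s.F.support, p ≤ degIn S d)
    (hperm : ∀ d ∈ s.F.support, degIn S s.r + (o - s.r.degree) ≤ degIn S d) :
    (step p S j b s).shade ≤ (PointBlowup.step p j b s.toState).shade := by
  obtain ⟨-, hqS, -⟩ := le_of_forall_le_degIn S s ho hr hperm hq
  have hdeg := (degree_step_r_add p hj b hbj hbN s ho hr hperm hqS).1
  have hN := (degree_step_r_add p hj b hbj hbN s ho hr hperm hqS).2
  have hφ := lift_step_F p hj b hbj hbN s hq
  by_cases ht : (step p S j b s).F = 0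
  · have hpt : (PointBlowup.step p j b s.toState).F = 0 := by rw [← hφ, ht, map_zero]
    unfold CState.shade PointBlowup.State.shade
    rw [ht, hpt, ordZero_zero, ENat.top_sub_coe, ENat.top_sub_coe]
  have hne : ordZero (step p S j b s).F ≠ ⊤ := by
    unfold ordZero
    rw [Ne, MvPowerSeries.order_eq_top_iff, MvPolynomial.coe_eq_zero_iff]
    exact ht
  obtain ⟨oG, hoG'⟩ := WithTop.ne_top_iff_exists.mp hne
  have hoG : ordZero (step p S j b s).F = oG := hoG'.symm
  have hrN : ∀ e ∈ (step p S j b s).F.support, s.r.degree - degIn S s.r ≤ e.degree - degIn S e := by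
    intro e he
    have hle := newMult_le_of_mem_support_step p S j b hbj s ho hr hperm e he
    have h1 := degIn_add_sum_compl S e
    have h2 := degIn_add_sum_compl S s.r
    have h3 : ∑ i ∈ Sᶜ, s.r i ≤ ∑ i ∈ Sᶜ, e i := Finset.sum_le_sum fun i hi => by
      rw [← hN i (Finset.mem_compl.mp hi)]
      exact Finsupp.le_def.mp hle i
    omega
  have hlift := le_ordZero_lift S j (step p S j b s).F hoG hrN
  rw [hφ] at hlift
  rw [CState.shade_eq_of_ordZero_eq _ hoG]
  unfold PointBlowup.State.shade
  rw [hdeg]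
  have e1 : ((oG - (step p S j b s).r.degree : ℕ) : ℕ∞) =
      ((oG + (s.r.degree - degIn S s.r) : ℕ) : ℕ∞) -
        (((step p S j b s).r.degree + (s.r.degree - degIn S s.r) : ℕ) : ℕ∞) := by
    rw [← ENat.coe_sub, Nat.add_sub_add_right]
  rw [e1]
  exact tsub_le_tsub_right hlift _

/-- **Moh's bound at order `p` for Moh-permissible coordinate centres, in every dimension.** Let
`s = (F, r)` be a cleaned state with `y^r ∣ F`, `S` a set of variables with `j ∈ S` such that every
monomial `y^d` of `F` has `degIn S d ≥ p` (the centre `C_S = {x = 0, y_i = 0 (i ∈ S)}` lies in the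
`p`-fold locus) and `degIn S d ≥ degIn S r + shade` (Moh's permissibility "`F ∈ P^d` where
`d = ord F`" for the residual factor, [Moh87] p. 967), and `b` a point of the fibre of the blow-up
of `C_S` over the origin, read in the `y_j`-chart (`b_j = 0`, `b_i = 0` off `S`). Then the shade
after the blow-up of `C_S` and the cleaning is at most the shade before plus one — Moh's
"`ord F̄ ≤ d + p^{e−1}`" ([Moh87] p. 966) for `e = 1` and permissible centres of ANY dimension,
transferred from the point case (`PointBlowup.mohBound_one`) by the comparison
`shade_step_le_shade_pointStep`. [cite: Moh1987, Stability Theorem (one permissible blow-up), §1]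
[cite: HauserPerlega2019PRIMS, §3 Theorem (9)] -/
theorem mohBound_one {S : Finset σ} {j : σ} (hj : j ∈ S) (b : σ → K) (hbj : b j = 0)
    (hbN : ∀ i, i ∉ S → b i = 0) (s : CState σ K) (hclean : deletePthPowers p s.F = s.F) {o : ℕ}
    (ho : ordZero s.F = o) (hr : ∀ d ∈ s.F.support, s.r ≤ d)
    (hq : ∀ d ∈ s.F.support, p ≤ degIn S d)
    (hperm : ∀ d ∈ s.F.support, degIn S s.r + (o - s.r.degree) ≤ degIn S d) :
    (step p S j b s).shade ≤ s.shade + 1 := by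
  obtain ⟨hpo, -, -⟩ := le_of_forall_le_degIn S s ho hr hperm hq
  have hM := PointBlowup.mohBound_one p j b hbj s.toState hclean (by
    show (p : ℕ∞) ≤ ordZero s.F
    rw [ho]; exact_mod_cast hpo) hr
  unfold PointBlowup.MohBound at hM
  rw [pow_one, Nat.sub_self, pow_zero, Nat.cast_one] at hM
  exact le_trans (shade_step_le_shade_pointStep p hj b hbj hbN s ho hr hq hperm) hM

/-- **Moh's witness forbids an increase under the blow-up of ANY Moh-permissible coordinate
centre** (every chart `j ∈ S`, every point of the fibre over the origin, every dimension): the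
`C_S`-version of `PointBlowup.shade_step_le_of_witness` (Moh's cases (1)–(2), p. 972, with the
centre `P ∋ x_s` of any dimension), by the comparison of shades. [cite: Moh1987, §1 (p. 972)] -/
theorem shade_step_le_of_witness {S : Finset σ} {j : σ} (hj : j ∈ S) (b : σ → K) (hbj : b j = 0)
    (hbN : ∀ i, i ∉ S → b i = 0) (s : CState σ K) {o : ℕ} (ho : ordZero s.F = o)
    (hr : ∀ d ∈ s.F.support, s.r ≤ d) (hq : ∀ d ∈ s.F.support, p ≤ degIn S d)
    (hperm : ∀ d ∈ s.F.support, degIn S s.r + (o - s.r.degree) ≤ degIn S d)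
    {i₀ : σ} (hri₀ : s.r i₀ = 0) {d₀ : σ →₀ ℕ} (hd₀ : d₀ ∈ s.F.support) (hd₀deg : d₀.degree = o)
    (hd₀i : ¬ p ∣ d₀ i₀) : (step p S j b s).shade ≤ s.shade := by
  obtain ⟨hpo, -, -⟩ := le_of_forall_le_degIn S s ho hr hperm hq
  exact le_trans (shade_step_le_shade_pointStep p hj b hbj hbN s ho hr hq hperm)
    (PointBlowup.shade_step_le_of_witness p j b hbj s.toState ho hpo hr hri₀ hd₀ hd₀deg hd₀i)

omit hp [CharP K p] in
/-- Bookkeeping: if the two shades after the step coincide, the order of the point-step residual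
polynomial exceeds that of the `C_S`-step one by exactly `Σ_{i∉S} r_i`. [folklore] -/
theorem ordZero_pointStep_eq {S : Finset σ} {j : σ} (hj : j ∈ S) (b : σ → K) (hbj : b j = 0)
    (hbN : ∀ i, i ∉ S → b i = 0) (s : CState σ K) {o : ℕ} (ho : ordZero s.F = o)
    (hr : ∀ d ∈ s.F.support, s.r ≤ d) {q : ℕ} (hq : ∀ d ∈ s.F.support, q ≤ degIn S d)
    (hperm : ∀ d ∈ s.F.support, degIn S s.r + (o - s.r.degree) ≤ degIn S d)
    {oG o₁ : ℕ} (hoG : ordZero (step q S j b s).F = oG)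
    (ho₁ : ordZero (PointBlowup.step q j b s.toState).F = o₁)
    (heq : (step q S j b s).shade = (PointBlowup.step q j b s.toState).shade) :
    o₁ = oG + (s.r.degree - degIn S s.r) ∧
      ∀ e ∈ (step q S j b s).F.support, s.r.degree - degIn S s.r ≤ e.degree - degIn S e := by
  obtain ⟨-, hqS, -⟩ := le_of_forall_le_degIn S s ho hr hperm hq
  have hdeg := (degree_step_r_add q hj b hbj hbN s ho hr hperm hqS).1
  have hN := (degree_step_r_add q hj b hbj hbN s ho hr hperm hqS).2
  have hr1 := newMult_le_of_mem_support_step q S j b hbj s ho hr hperm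
  have hrN : ∀ e ∈ (step q S j b s).F.support, s.r.degree - degIn S s.r ≤ e.degree - degIn S e := by
    intro e he
    have hle := hr1 e he
    have h1 := degIn_add_sum_compl S e
    have h2 := degIn_add_sum_compl S s.r
    have h3 : ∑ i ∈ Sᶜ, s.r i ≤ ∑ i ∈ Sᶜ, e i := Finset.sum_le_sum fun i hi => by
      rw [← hN i (Finset.mem_compl.mp hi)]
      exact Finsupp.le_def.mp hle i
    omega
  refine ⟨?_, hrN⟩
  have hlift := le_ordZero_lift S j (step q S j b s).F hoG hrN
  rw [lift_step_F q hj b hbj hbN s hq, ho₁] at hlift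
  have hlift' : oG + (s.r.degree - degIn S s.r) ≤ o₁ := by exact_mod_cast hlift
  obtain ⟨⟨E₁, hE₁, hE₁deg⟩, -⟩ := (ordZero_eq_nat_iff _ _).mp hoG
  have hrle : (step q S j b s).r.degree ≤ oG :=
    hE₁deg ▸ PointBlowup.degree_le_degree_of_le (hr1 E₁ (MvPolynomial.mem_support_iff.mpr hE₁))
  rw [CState.shade_eq_of_ordZero_eq _ hoG, PointBlowup.shade_eq_of_ordZero_eq _ ho₁, hdeg] at heq
  have heq' : oG - (step q S j b s).r.degree =
      o₁ - ((step q S j b s).r.degree + (s.r.degree - degIn S s.r)) := by exact_mod_cast heq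
  omega

/-- **An increase of the shade under a Moh-permissible `C_S`-blow-up creates Moh's witness**
(the `C_S`-version of `PointBlowup.exists_nonexceptional_of_shadeIncreases`): the new state has
a NON-exceptional variable (`i₀ ≠ j`, a component lost at `b`) occurring in an initial monomial
with an exponent prime to `p`. [cite: Moh1987, §1 (Statement (i)–(iii), p. 972)] -/
theorem exists_witness_of_shadeIncreases {S : Finset σ} {j : σ} (hj : j ∈ S) (b : σ → K)
    (hbj : b j = 0) (hbN : ∀ i, i ∉ S → b i = 0) (s : CState σ K)
    (hclean : deletePthPowers p s.F = s.F) {o : ℕ} (ho : ordZero s.F = o)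
    (hr : ∀ d ∈ s.F.support, s.r ≤ d) (hq : ∀ d ∈ s.F.support, p ≤ degIn S d)
    (hperm : ∀ d ∈ s.F.support, degIn S s.r + (o - s.r.degree) ≤ degIn S d)
    (hinc : ShadeIncreases p S j b s) :
    ∃ (i₀ : σ) (o₁ : ℕ) (E : σ →₀ ℕ), ordZero (step p S j b s).F = o₁ ∧
      E ∈ (step p S j b s).F.support ∧ E.degree = o₁ ∧ ¬ p ∣ E i₀ ∧ (step p S j b s).r i₀ = 0 := by
  obtain ⟨hpo, -, -⟩ := le_of_forall_le_degIn S s ho hr hperm hq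
  have hcmp := shade_step_le_shade_pointStep p hj b hbj hbN s ho hr hq hperm
  unfold ShadeIncreases at hinc
  have hinc' : PointBlowup.ShadeIncreases p j b s.toState := by
    unfold PointBlowup.ShadeIncreases
    exact lt_of_lt_of_le hinc hcmp
  obtain ⟨i₀, hi₀, -, -, hr1i₀, o₁, ho₁, ho₁eq, E, hE, hEdeg, hEi₀, -⟩ :=
    PointBlowup.exists_nonexceptional_of_shadeIncreases p j b hbj s.toState hclean ho hpo hr hinc'
  -- the centre-step residual polynomial is non-zero, of order `oG`
  have hF1 : (step p S j b s).F ≠ 0 := step_F_ne_zero p hj b hbj hbN s hclean ho hr hq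
  have hne : ordZero (step p S j b s).F ≠ ⊤ := by
    unfold ordZero
    rw [Ne, MvPowerSeries.order_eq_top_iff, MvPolynomial.coe_eq_zero_iff]
    exact hF1
  obtain ⟨oG, hoG'⟩ := WithTop.ne_top_iff_exists.mp hne
  have hoG : ordZero (step p S j b s).F = oG := hoG'.symm
  -- both shades equal `shade + 1`
  have hM := PointBlowup.mohBound_one p j b hbj s.toState hclean (by
    show (p : ℕ∞) ≤ ordZero s.F
    rw [ho]; exact_mod_cast hpo) hr
  unfold PointBlowup.MohBound at hM
  rw [pow_one, Nat.sub_self, pow_zero, Nat.cast_one] at hM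
  have heq : (step p S j b s).shade = (PointBlowup.step p j b s.toState).shade := by
    refine le_antisymm hcmp ?_
    have h1 : s.shade < (step p S j b s).shade := hinc
    rw [CState.shade_eq_of_ordZero_eq s ho, CState.shade_eq_of_ordZero_eq _ hoG] at h1
    rw [PointBlowup.shade_eq_of_ordZero_eq _ ho₁, PointBlowup.shade_eq_of_ordZero_eq _ ho] at hM
    rw [CState.shade_eq_of_ordZero_eq _ hoG, PointBlowup.shade_eq_of_ordZero_eq _ ho₁]
    have h1' : o - s.r.degree < oG - (step p S j b s).r.degree := by exact_mod_cast h1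
    have h2' : o₁ - (PointBlowup.step p j b s.toState).r.degree ≤ o - s.r.degree + 1 := by
      exact_mod_cast hM
    exact_mod_cast (show o₁ - (PointBlowup.step p j b s.toState).r.degree
      ≤ oG - (step p S j b s).r.degree by omega)
  obtain ⟨ho₁G, hrN⟩ := ordZero_pointStep_eq hj b hbj hbN s ho hr hq hperm hoG ho₁ heq
  -- pull the witness monomial back through `φ`
  rw [← lift_step_F p hj b hbj hbN s hq] at hE
  obtain ⟨e, he, rfl⟩ := exists_of_mem_support_lift S j _ hE
  obtain ⟨hedeg, -⟩ := degree_eq_of_lift_initial S j _ hoG hrN he (by rw [hEdeg, ho₁G])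
  refine ⟨i₀, oG, e, hoG, he, hedeg, ?_, ?_⟩
  · rwa [lift_apply, if_neg hi₀] at hEi₀
  · rw [step_r_apply_of_ne p S hi₀ b s]; exact hr1i₀

/-- **Persistence of Moh's witness under a stall, for Moh-permissible coordinate centres**
(the `C_S`-version of `PointBlowup.exists_witness_step_of_shade_eq`). [cite: Moh1987, §1 (p. 972–973)] -/
theorem exists_witness_step_of_shade_eq {S : Finset σ} {j : σ} (hj : j ∈ S) (b : σ → K)
    (hbj : b j = 0) (hbN : ∀ i, i ∉ S → b i = 0) (s : CState σ K)
    (hclean : deletePthPowers p s.F = s.F) {o : ℕ} (ho : ordZero s.F = o)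
    (hr : ∀ d ∈ s.F.support, s.r ≤ d) (hq : ∀ d ∈ s.F.support, p ≤ degIn S d)
    (hperm : ∀ d ∈ s.F.support, degIn S s.r + (o - s.r.degree) ≤ degIn S d)
    {i₀ : σ} (hri₀ : s.r i₀ = 0) {d₀ : σ →₀ ℕ} (hd₀ : d₀ ∈ s.F.support) (hd₀deg : d₀.degree = o)
    (hd₀i : ¬ p ∣ d₀ i₀) (hstall : (step p S j b s).shade = s.shade) :
    ∃ (i₁ : σ) (o₁ : ℕ) (E : σ →₀ ℕ), ordZero (step p S j b s).F = o₁ ∧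
      E ∈ (step p S j b s).F.support ∧ E.degree = o₁ ∧ ¬ p ∣ E i₁ ∧ (step p S j b s).r i₁ = 0 := by
  obtain ⟨hpo, hqS, hro⟩ := le_of_forall_le_degIn S s ho hr hperm hq
  have hcmp := shade_step_le_shade_pointStep p hj b hbj hbN s ho hr hq hperm
  have hpt := PointBlowup.shade_step_le_of_witness p j b hbj s.toState ho hpo hr hri₀ hd₀ hd₀deg hd₀i
  have heq : (step p S j b s).shade = (PointBlowup.step p j b s.toState).shade :=
    le_antisymm hcmp (le_trans hpt (le_of_eq hstall.symm))
  have hstall' : (PointBlowup.step p j b s.toState).shade = s.toState.shade := by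
    rw [← heq, hstall]; rfl
  obtain ⟨i₁, o₁, E, ho₁, hE, hEdeg, hEi, hri⟩ :=
    PointBlowup.exists_witness_step_of_shade_eq p j b hbj s.toState ho hpo hr hri₀ hd₀ hd₀deg hd₀i
      hstall'
  have hF1 : (step p S j b s).F ≠ 0 := step_F_ne_zero p hj b hbj hbN s hclean ho hr hq
  have hne : ordZero (step p S j b s).F ≠ ⊤ := by
    unfold ordZero
    rw [Ne, MvPowerSeries.order_eq_top_iff, MvPolynomial.coe_eq_zero_iff]
    exact hF1
  obtain ⟨oG, hoG'⟩ := WithTop.ne_top_iff_exists.mp hne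
  have hoG : ordZero (step p S j b s).F = oG := hoG'.symm
  obtain ⟨ho₁G, hrN⟩ := ordZero_pointStep_eq hj b hbj hbN s ho hr hq hperm hoG ho₁ heq
  rw [← lift_step_F p hj b hbj hbN s hq] at hE
  obtain ⟨e, he, rfl⟩ := exists_of_mem_support_lift S j _ hE
  obtain ⟨hedeg, hecod⟩ := degree_eq_of_lift_initial S j _ hoG hrN he (by rw [hEdeg, ho₁G])
  by_cases hi₁ : i₁ = j
  · -- the witness sits at the chart variable: then `o = p`, `Σ_{i∉S} r_i = 0`, and `ψ e = e`
    subst hi₁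
    have hrpt : (PointBlowup.step p i₁ b s.toState).r i₁ = o - p := by
      show PointBlowup.newMult p i₁ b s.toState i₁ = o - p
      rw [PointBlowup.newMult_eq p i₁ b hbj s.toState ho, Finsupp.filter_apply, if_pos hbj,
        Finsupp.update_apply, if_pos rfl]
    rw [hrpt] at hri
    have hSle := degIn_le_degree S s.r
    have hcod0 : s.r.degree - degIn S s.r = 0 := by omega
    rw [hcod0] at hecod
    have hψ : e + Finsupp.single i₁ (e.degree - degIn S e) = e := by
      rw [hecod, Finsupp.single_zero, add_zero]
    rw [hψ] at hEi
    refine ⟨i₁, oG, e, hoG, he, hedeg, hEi, ?_⟩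
    rw [step_r_eq p S i₁ b hbj s ho hr hperm, Finsupp.filter_apply, if_pos hbj, Finsupp.update_apply,
      if_pos rfl]
    omega
  · refine ⟨i₁, oG, e, hoG, he, hedeg, ?_, ?_⟩
    · rwa [lift_apply, if_neg hi₁] at hEi
    · rw [step_r_apply_of_ne p S hi₁ b s]; exact hri

end Transfer


/-! ## 4. Moh's stability theorem along sequences of coordinate-centre blow-ups -/

section Along

variable {σ : Type*} {K : Type*} [Field K] [Fintype σ] [DecidableEq σ] [DecidableEq K]
variable (p : ℕ) [hp : Fact p.Prime] [CharP K p]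

/-- **Moh's Stability Theorem at order `p` (`e = 1`) for permissible coordinate centres of any
dimension, in every dimension.** Follow ANY sequence of blow-ups `s_{n+1} = step p (S n) (j n)
(b n) s_n` of coordinate centres `C_{S_n} = {x = 0, y_i = 0 (i ∈ S_n)}` — at each stage an
arbitrary set of variables `S_n ∋ j n`, read in the chart `y_{j n}` at an arbitrary point `b n`
of the fibre over the origin (`b n (j n) = 0`, `b n i = 0` off `S_n`) — such that each centre is
Moh-permissible for the current state (every monomial `y^d` of `F_n` has `degIn S_n d ≥ p` and
`degIn S_n d ≥ degIn S_n r_n + shade_n`: `C_{S_n}` lies in the `p`-fold locus and in the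
equimultiple locus of the residual factor, [Moh87] p. 967 (3)), starting from a cleaned state
(`F ≠ 0`, no `p`-th power monomials, `y^r ∣ F`). Then `shade(s_m) ≤ shade(s_n) + 1` for all
`n ≤ m`: the shade never exceeds its running minimum by more than one, whatever the dimensions
of the centres — Moh's "successive permissible blow-ups will not increase `ord F̄` beyond the
bound `d + p^{e−1}` … until it drops to `d` or less" for `e = 1`, without the valuation. Point
blow-ups are the case `S_n = univ` (`PointBlowup.shade_le_shade_add_one_along`). Proof: the point
case transferred through `φ` — a jump creates Moh's witness (`exists_witness_of_shadeIncreases`),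
which forbids a further jump under every permissible centre (`shade_step_le_of_witness`) and
survives stalls (`exists_witness_step_of_shade_eq`). [cite: Moh1987, Stability Theorem
(Introduction p. 966) and §1 (pp. 972–973)] [cite: HauserPerlega2019, §3] -/
theorem shade_le_shade_add_one_along (s : ℕ → CState σ K) (S : ℕ → Finset σ) (j : ℕ → σ)
    (b : ℕ → σ → K) (hj : ∀ n, j n ∈ S n) (hb : ∀ n, b n (j n) = 0)
    (hbN : ∀ n i, i ∉ S n → b n i = 0)
    (hstep : ∀ n, s (n + 1) = step p (S n) (j n) (b n) (s n))
    (hF0 : (s 0).F ≠ 0) (hclean : deletePthPowers p (s 0).F = (s 0).F)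
    (hr : ∀ d ∈ (s 0).F.support, (s 0).r ≤ d)
    (hq : ∀ n, ∀ d ∈ (s n).F.support, p ≤ degIn (S n) d)
    (hperm : ∀ n, ∀ d ∈ (s n).F.support,
      ((degIn (S n) (s n).r : ℕ) : ℕ∞) + (s n).shade ≤ (degIn (S n) d : ℕ))
    {n m : ℕ} (hnm : n ≤ m) : (s m).shade ≤ (s n).shade + 1 := by
  -- natural-number form of the permissibility at a state of order `o`
  have hpermN : ∀ n (o : ℕ), ordZero (s n).F = o → ∀ d ∈ (s n).F.support,
      degIn (S n) (s n).r + (o - (s n).r.degree) ≤ degIn (S n) d := by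
    intro n o ho d hd
    have h := hperm n d hd
    rw [CState.shade_eq_of_ordZero_eq _ ho] at h
    exact_mod_cast h
  -- invariants along the sequence: non-zero, cleaned, divisible by the exceptional monomial
  have hinv : ∀ n, (s n).F ≠ 0 ∧ deletePthPowers p (s n).F = (s n).F ∧
      ∀ d ∈ (s n).F.support, (s n).r ≤ d := by
    intro n
    induction n with
    | zero => exact ⟨hF0, hclean, hr⟩
    | succ n ih =>
      obtain ⟨ih0, ih1, ih2⟩ := ih
      have hne : ordZero (s n).F ≠ ⊤ := by
        unfold ordZero
        rw [Ne, MvPowerSeries.order_eq_top_iff, MvPolynomial.coe_eq_zero_iff]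
        exact ih0
      obtain ⟨o, ho'⟩ := WithTop.ne_top_iff_exists.mp hne
      have ho : ordZero (s n).F = o := ho'.symm
      rw [hstep n]
      exact ⟨step_F_ne_zero p (hj n) (b n) (hb n) (hbN n) (s n) ih1 ho ih2 (hq n),
        deletePthPowers_step p (S n) (j n) (b n) (s n),
        newMult_le_of_mem_support_step p (S n) (j n) (b n) (hb n) (s n) ho ih2 (hpermN n o ho)⟩
  -- natural-number orders
  have hnat : ∀ n, ∃ o : ℕ, ordZero (s n).F = o := by
    intro n
    obtain ⟨h0, -, -⟩ := hinv n
    have hne : ordZero (s n).F ≠ ⊤ := by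
      unfold ordZero
      rw [Ne, MvPowerSeries.order_eq_top_iff, MvPolynomial.coe_eq_zero_iff]
      exact h0
    obtain ⟨o, ho'⟩ := WithTop.ne_top_iff_exists.mp hne
    exact ⟨o, ho'.symm⟩
  -- the witness predicate
  let W : CState σ K → Prop := fun t =>
    ∃ (i : σ) (o : ℕ) (E : σ →₀ ℕ), ordZero t.F = o ∧ E ∈ t.F.support ∧ E.degree = o ∧
      ¬ p ∣ E i ∧ t.r i = 0
  obtain ⟨a, ha⟩ := hnat n
  have hshade_n : (s n).shade = ((a - (s n).r.degree : ℕ) : ℕ∞) :=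
    CState.shade_eq_of_ordZero_eq _ ha
  obtain ⟨k, rfl⟩ := Nat.exists_eq_add_of_le hnm
  clear hnm
  suffices hk : (s (n + k)).shade ≤ (s n).shade + 1 ∧
      ((s (n + k)).shade = (s n).shade + 1 → W (s (n + k))) from hk.1
  induction k with
  | zero =>
    refine ⟨le_self_add, fun h => ?_⟩
    exfalso
    rw [Nat.add_zero, hshade_n] at h
    have : (a - (s n).r.degree : ℕ) = (a - (s n).r.degree) + 1 := by exact_mod_cast h
    omega
  | succ k ih =>
    obtain ⟨ih1, ih2⟩ := ih
    obtain ⟨-, hcl, hrk⟩ := hinv (n + k)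
    obtain ⟨o, ho⟩ := hnat (n + k)
    have hpk := hpermN (n + k) o ho
    have hstepk : s (n + (k + 1)) = step p (S (n + k)) (j (n + k)) (b (n + k)) (s (n + k)) := by
      rw [← Nat.add_assoc]; exact hstep (n + k)
    have hshade_k : (s (n + k)).shade = ((o - (s (n + k)).r.degree : ℕ) : ℕ∞) :=
      CState.shade_eq_of_ordZero_eq _ ho
    by_cases htop : (s (n + k)).shade = (s n).shade + 1
    · -- at the top: the witness forbids an increase and survives a stall
      obtain ⟨i₀, o', E, ho', hE, hEdeg, hEi, hri⟩ := ih2 htop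
      have hoo : o' = o := by
        have := ho'.symm.trans ho
        exact_mod_cast this
      subst hoo
      have hle := shade_step_le_of_witness p (hj (n + k)) (b (n + k)) (hb (n + k)) (hbN (n + k))
        (s (n + k)) ho' hrk (hq (n + k)) hpk hri hE hEdeg hEi
      rw [← hstepk] at hle
      refine ⟨le_trans hle (le_of_eq htop), fun heq => ?_⟩
      have hstall : (step p (S (n + k)) (j (n + k)) (b (n + k)) (s (n + k))).shade
          = (s (n + k)).shade := by
        rw [← hstepk, heq, htop]
      obtain ⟨i₁, o₁, E₁, ho₁, hE₁, hE₁deg, hE₁i, hr₁⟩ :=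
        exists_witness_step_of_shade_eq p (hj (n + k)) (b (n + k)) (hb (n + k)) (hbN (n + k))
          (s (n + k)) hcl ho' hrk (hq (n + k)) hpk hri hE hEdeg hEi hstall
      rw [← hstepk] at ho₁ hE₁ hr₁
      exact ⟨i₁, o₁, E₁, ho₁, hE₁, hE₁deg, hE₁i, hr₁⟩
    · -- below the top: Moh's one-step bound, and an increase creates the witness
      have hlt : (s (n + k)).shade < (s n).shade + 1 := lt_of_le_of_ne ih1 htop
      have hle : (s (n + k)).shade ≤ (s n).shade := by
        rw [hshade_k, hshade_n] at hlt ⊢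
        have : (o - (s (n + k)).r.degree : ℕ) < (a - (s n).r.degree) + 1 := by exact_mod_cast hlt
        exact_mod_cast (by omega : (o - (s (n + k)).r.degree : ℕ) ≤ (a - (s n).r.degree))
      have hM := mohBound_one p (hj (n + k)) (b (n + k)) (hb (n + k)) (hbN (n + k)) (s (n + k))
        hcl ho hrk (hq (n + k)) hpk
      rw [← hstepk] at hM
      refine ⟨le_trans hM (add_le_add hle le_rfl), fun heq => ?_⟩
      have hinc : ShadeIncreases p (S (n + k)) (j (n + k)) (b (n + k)) (s (n + k)) := by
        unfold ShadeIncreases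
        rw [← hstepk, heq]
        exact lt_of_le_of_lt hle (by
          rw [hshade_n]
          exact_mod_cast (by omega : (a - (s n).r.degree : ℕ) < (a - (s n).r.degree) + 1))
      obtain ⟨i₀, o₁, E, ho₁, hE, hEdeg, hEi₀, hr1i₀⟩ :=
        exists_witness_of_shadeIncreases p (hj (n + k)) (b (n + k)) (hb (n + k)) (hbN (n + k))
          (s (n + k)) hcl ho hrk (hq (n + k)) hpk hinc
      rw [← hstepk] at ho₁ hE hr1i₀
      exact ⟨i₀, o₁, E, ho₁, hE, hEdeg, hEi₀, hr1i₀⟩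

/-- **Moh's phrasing, for permissible coordinate centres of any dimension**: after an increase
from `d = shade(s_n)` the shade EQUALS `d + 1` at every later stage it has not returned to `≤ d`.
[cite: Moh1987, Stability Theorem ("until it drops to d or less")] -/
theorem shade_eq_add_one_until_drop (s : ℕ → CState σ K) (S : ℕ → Finset σ) (j : ℕ → σ)
    (b : ℕ → σ → K) (hj : ∀ n, j n ∈ S n) (hb : ∀ n, b n (j n) = 0)
    (hbN : ∀ n i, i ∉ S n → b n i = 0)
    (hstep : ∀ n, s (n + 1) = step p (S n) (j n) (b n) (s n))
    (hF0 : (s 0).F ≠ 0) (hclean : deletePthPowers p (s 0).F = (s 0).F)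
    (hr : ∀ d ∈ (s 0).F.support, (s 0).r ≤ d)
    (hq : ∀ n, ∀ d ∈ (s n).F.support, p ≤ degIn (S n) d)
    (hperm : ∀ n, ∀ d ∈ (s n).F.support,
      ((degIn (S n) (s n).r : ℕ) : ℕ∞) + (s n).shade ≤ (degIn (S n) d : ℕ))
    {n m : ℕ} (hnm : n ≤ m) (hnodrop : (s n).shade < (s m).shade) :
    (s m).shade = (s n).shade + 1 :=
  le_antisymm (shade_le_shade_add_one_along p s S j b hj hb hbN hstep hF0 hclean hr hq hperm hnm)
    (Order.add_one_le_of_lt hnodrop)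

end Along


/-! ## 5. Consistency: the point blow-up is the blow-up of `C_univ` -/

section Univ

variable {σ : Type*} {K : Type*} [Field K] [Fintype σ] [DecidableEq σ] [DecidableEq K]

omit [DecidableEq σ] [DecidableEq K] in
/-- The order along the centre `C_univ` (the point) is the order at the origin. [folklore] -/
theorem ordAlong_univ (F : MvPolynomial σ K) : ordAlong Finset.univ F = ordZero F := by
  by_cases hF : F = 0
  · rw [hF, ordZero_zero]
    unfold ordAlong
    rw [MvPolynomial.support_zero, Finset.inf_empty]
  have hne : ordZero F ≠ ⊤ := by
    unfold ordZero
    rw [Ne, MvPowerSeries.order_eq_top_iff, MvPolynomial.coe_eq_zero_iff]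
    exact hF
  obtain ⟨o, ho'⟩ := WithTop.ne_top_iff_exists.mp hne
  have ho : ordZero F = o := ho'.symm
  obtain ⟨⟨d₀, hd₀, hd₀deg⟩, hmin⟩ := (ordZero_eq_nat_iff _ _).mp ho
  rw [ho]
  unfold ordAlong
  refine le_antisymm ?_ ?_
  · refine le_trans (Finset.inf_le (MvPolynomial.mem_support_iff.mpr hd₀)) ?_
    rw [degIn_univ, hd₀deg]
  · refine Finset.le_inf fun d hd => ?_
    rw [degIn_univ]
    have : o ≤ d.degree := by
      by_contra h
      exact (MvPolynomial.mem_support_iff.mp hd) (hmin d (not_le.mp h))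
    exact_mod_cast this

omit [DecidableEq K] in
/-- The `C_univ`-chart transform is the point chart transform. [folklore] -/
theorem chartTransform_univ (q : ℕ) (j : σ) (F : MvPolynomial σ K) :
    chartTransform q Finset.univ j F = PointBlowup.chartTransform q j F := by
  unfold chartTransform PointBlowup.chartTransform
  exact Finset.sum_congr rfl fun d _ => by rw [chartExponent_univ]

/-- **A step of the blow-up of `C_univ` is a step of the point blow-up** (same residual
polynomial, same multiplicities): the theorems of §4 contain those of
`PointBlowupMohStability.lean`. [folklore] -/
theorem step_univ_toState (q : ℕ) (j : σ) (b : σ → K) (s : CState σ K) :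
    (step q Finset.univ j b s).toState = PointBlowup.step q j b s.toState := by
  show PointBlowup.State.mk (deletePthPowers q (PointBlowup.translate b (chartTransform q Finset.univ j s.F)))
      (newMult q Finset.univ j b s) = _
  unfold newMult PointBlowup.step PointBlowup.pointTransform PointBlowup.newMult
  rw [chartTransform_univ, ordAlong_univ]
  rfl

end Univ

end CentreBlowup

end Literature.AlgebraicGeometry.Resolution
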